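import Mathlib
import HarnessLib
import Literature.Probability.LatticeModels.TorusSymbolSampling
import Literature.Probability.LatticeModels.SampledSymbolDifferences
import Literature.Probability.LatticeModels.TorusFourierDyadicBlocks
import Literature.Analysis.Calculus.IteratedDifferenceDerivBound
import Summits.HubbardSuperconductivity.HubbardSuperconductivity.Theorems.KLProgrammeKLRegimeTorusL1DyadicSuperposition

/-!
# Route `KLProgramme` — engine support (row (X).1 / #14 «S3 IN U-CURRENCY», NORM side, brick (T4)): CANONICAL PRODUCT BUMPS on the space-time dual torus
# satisfy the bump hypotheses of (T1)/(T2) with explicit rates — so a producer of the pair-transfer representation only supplies amplitudes and remainders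

Cell gate-hubbard-kl, seat hubbard-kl-k3c2-p3 (g16).  Bricks (T1) `sum_norm_charSum_bump_le` / (T2) `fixedTupleL1_le_of_pairTransfer_bump` take an abstract symbol
`G` on `(ℤ/P)¹ × (ℤ/L)²` with bump data (support `≤ n₀(s₀P)(s₁L)²`, sup `≤ A`, axis second differences `≤ A(4/(s₀P))²`, `≤ A(4/(s₁L))²`).  Here the canonical
choice is typed once and for all: a `C²` profile `φ : ℝ → ℝ` with `|φ| ≤ 1`, `|φ''| ≤ K` (`K ≥ 1`), `φ(t) = 0` for `|t| ≥ 1`, and integer radii `R₀, R₁ ≥ 1`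
(`≍ βΛ/π` frequencies, `≍ LΛ/2π` momenta at scale `Λ`), sampled through the CENTRED representatives:
`G(q) = φ(q̃₁/R₀) · φ((q̃₂)₀/R₁) · φ((q̃₂)₁/R₁)`.

* §1 `fwdDiff_iter_eq_of_line`, `abs_fwdDiff_two_rescaled_le` — lattice second differences of `s ↦ φ((c+s)/R)` are `≤ K/R²` (twofold mean value theorem,
  `Literature.Analysis.Calculus.norm_fwdDiff_iter_le_of_norm_iteratedDeriv_le`);
* §2 the one-dimensional sampled bump `a ↦ φ(ã/R)` on `ℤ/n`: vanishing for `|ã| ≥ R`, support `≤ 4R` (`card_filter_natAbs_valMinAbs_lt`);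
* §3 the time factor on `(ℤ/P)¹` and the space factor on `(ℤ/L)²`: pointwise axis second differences `≤ K/R₀²`, `≤ K/R₁²` when `2R₀ + 4 ≤ P`, `2R₁ + 4 ≤ L`
  (no wrap at the seam: `TorusSymbolSampling.fwdDiff_iter_comp_section` + `section_consistent_valMinAbs`);
* §4 **`productBump_bumpData`** — the product `G`: `‖G‖ ≤ 1`, `#{G ≠ 0} ≤ 64·R₀R₁²`, time/axis second differences `≤ K/R₀²`, `≤ K/R₁²`;
  **`sum_norm_charSum_productBump_le`** — with `4R₀ ≤ P`, `4R₁ ≤ L` (and `2R₀+4 ≤ P`, `2R₁+4 ≤ L`): `Σ_z ‖Σ_q χ_q(z)•G(q)‖ ≤ √(10485760·K·√K) · (P·L²)` (rates `s₀ = 4R₀/(√K·P)`,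
  `s₁ = 4R₁/(√K·L)`, `n₀ = K√K`, `A = 1` in (T1)) — uniformly in the radii, i.e. in the scale;
* §5 `charSum_translate`, **`sum_norm_charSum_translate`** — translating the symbol by `Q` (a particle–hole transfer centred at a nesting vector) multiplies the
  character sum by a character: the `ℓ¹` norm is unchanged.

Everything is proved; no definitions, no named facts; nothing asserts any engine row, (X).1, K3 or superconductivity. [folklore]  Refs: Katznelson, Ch. I §6.3; Zygmund I, Ch. VI §3.
-/

noncomputable section

namespace Summit.HubbardSuperconductivity.HubbardSuperconductivity.Theorems.TorusFourierL2

set_option linter.dupNamespace false -- summit = problem name (single-conjunct summit), D-0017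

open Finset Complex Literature.Probability.LatticeModels Literature.Analysis.Calculus
open scoped Real

/-! ### §1 Lattice second differences of a rescaled `C²` profile -/

/-- Differences along a lattice line are differences of the restriction to the line. [folklore] -/
theorem fwdDiff_iter_eq_of_line {A : Type*} [AddCommMonoid A] (f : A → ℝ) (v m : A) (ψ : ℝ → ℝ)
    (hψ : ∀ k : ℕ, f (m + k • v) = ψ k) (N : ℕ) : ((fwdDiff v)^[N] f) m = ((fwdDiff (1 : ℝ))^[N] ψ) 0 := by
  rw [fwdDiff_iter_eq_sum_shift, fwdDiff_iter_eq_sum_shift]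
  refine sum_congr rfl fun k _ => ?_
  rw [hψ k, zero_add, nsmul_eq_mul, mul_one]

/-- **Second differences of a rescaled profile**: if `φ` is `C²` with `|φ''| ≤ K` then `|φ((c+2)/R) − 2φ((c+1)/R) + φ(c/R)| ≤ K/R²` (`R > 0`).
[cite: Katznelson2004, Ch. I §6.3] -/
theorem abs_fwdDiff_two_rescaled_le (φ : ℝ → ℝ) (hφ : ContDiff ℝ 2 φ) {K : ℝ} (hK : ∀ t, |iteratedDeriv 2 φ t| ≤ K) {R : ℝ} (hR : 0 < R) (c : ℝ) :
    |((fwdDiff (1 : ℝ))^[2] (fun s => φ ((c + s) / R))) 0| ≤ K / R ^ 2 := by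
  set ψ : ℝ → ℝ := fun s => φ (R⁻¹ * (c + s)) with hψdef
  have hψeq : (fun s => φ ((c + s) / R)) = ψ := by
    funext s; simp only [hψdef, div_eq_inv_mul]
  rw [hψeq]
  have hg : ContDiff ℝ 2 (fun x => φ (R⁻¹ * x)) := hφ.comp (contDiff_const.mul contDiff_id)
  have hψc : ContDiff ℝ 2 ψ := hg.comp (contDiff_const.add contDiff_id)
  have hder : ∀ s, iteratedDeriv 2 ψ s = (R⁻¹) ^ 2 * iteratedDeriv 2 φ (R⁻¹ * (c + s)) := by
    intro s
    have h1 : ψ = fun z => (fun x => φ (R⁻¹ * x)) (c + z) := rfl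
    rw [h1, iteratedDeriv_comp_const_add 2 (fun x => φ (R⁻¹ * x)) c]
    show iteratedDeriv 2 (fun x => φ (R⁻¹ * x)) (c + s) = _
    rw [iteratedDeriv_comp_const_mul hφ]
  have hbound : ∀ s ∈ Set.Icc (0 : ℝ) (0 + 2 * 1), ‖iteratedDeriv 2 ψ s‖ ≤ K / R ^ 2 := by
    intro s _
    rw [hder, Real.norm_eq_abs, abs_mul, abs_of_nonneg (by positivity : (0 : ℝ) ≤ (R⁻¹) ^ 2), inv_pow, div_eq_inv_mul]
    exact mul_le_mul_of_nonneg_left (hK _) (by positivity)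
  have h := norm_fwdDiff_iter_le_of_norm_iteratedDeriv_le 2 ψ hψc (h := 1) zero_le_one 0 (K := K / R ^ 2) (by simpa using hbound)
  rw [one_pow, one_mul, Real.norm_eq_abs] at h
  exact h

/-! ### §2 One-dimensional sampled bumps `a ↦ φ(ã/R)` on `ℤ/n` -/

/-- A profile vanishing outside `(-1, 1)`, sampled at `ã/R`, vanishes for `|ã| ≥ R`. [folklore] -/
theorem sampledBump_eq_zero {n : ℕ} (φ : ℝ → ℝ) (hφ0 : ∀ t, 1 ≤ |t| → φ t = 0) {R : ℕ} (hR : 0 < R) (a : ZMod n)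
    (ha : (R : ℤ) ≤ |a.valMinAbs|) : φ ((a.valMinAbs : ℝ) / R) = 0 := by
  refine hφ0 _ ?_
  have hR' : (0 : ℝ) < R := by exact_mod_cast hR
  rw [abs_div, abs_of_pos hR', le_div_iff₀ hR', one_mul]
  exact_mod_cast ha

/-- The support of a sampled bump has at most `4R` points. [cite: Zygmund2002, Ch. VI §3] -/
theorem card_support_sampledBump_le {n : ℕ} [NeZero n] (φ : ℝ → ℝ) (hφ0 : ∀ t, 1 ≤ |t| → φ t = 0) {R : ℕ} (hR : 0 < R) :
    (univ.filter fun a : ZMod n => φ ((a.valMinAbs : ℝ) / R) ≠ 0).card ≤ 4 * R := by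
  refine le_trans (card_le_card fun a ha => ?_) (card_filter_natAbs_valMinAbs_lt (L := n) R)
  simp only [mem_filter, mem_univ, true_and] at ha ⊢
  by_contra hlt
  have hle : 2 * R ≤ a.valMinAbs.natAbs := not_lt.1 hlt
  exact ha (sampledBump_eq_zero φ hφ0 hR a (by
    have : (R : ℤ) ≤ (a.valMinAbs.natAbs : ℤ) := by exact_mod_cast (le_trans (by omega) hle)
    simpa [Int.natCast_natAbs] using this))

/-! ### §3 The time factor on `(ℤ/P)¹` and the space factor on `(ℤ/L)²`: pointwise second differences, no wrap -/

/-- **Time factor**: for `2R₀ + 4 ≤ P`, the second difference of `a ↦ φ(ã₀/R₀)` along `(1)` is `≤ K/R₀²` pointwise. [cite: Katznelson2004, Ch. I §6.3] -/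
theorem abs_fwdDiff_two_timeBump_le {P : ℕ} [NeZero P] (φ : ℝ → ℝ) (hφ : ContDiff ℝ 2 φ) {K : ℝ} (hK : ∀ t, |iteratedDeriv 2 φ t| ≤ K)
    (hφ0 : ∀ t, 1 ≤ |t| → φ t = 0) {R₀ : ℕ} (hR₀ : 0 < R₀) (hP : 2 * R₀ + 4 ≤ P) (a : TorusSite 1 P) :
    |((fwdDiff (fun _ : Fin 1 => (1 : ZMod P)))^[2] (fun b : TorusSite 1 P => φ (((b 0).valMinAbs : ℝ) / R₀))) a| ≤ K / (R₀ : ℝ) ^ 2 := by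
  set f : (Fin 1 → ℤ) → ℝ := fun m => φ ((m 0 : ℝ) / R₀) with hf
  have hsupp : ∀ m : Fin 1 → ℤ, (∃ j, (P : ℤ) ≤ 2 * |m j| + 2 * (2 : ℕ) * |(fun _ : Fin 1 => (1 : ℤ)) j|) → f m = 0 := by
    rintro m ⟨j, hj⟩
    have hj0 : j = 0 := Subsingleton.elim _ _
    subst hj0
    simp only [abs_one, mul_one] at hj
    have hm : (R₀ : ℤ) ≤ |m 0| := by push_cast at hj hP ⊢; omega
    simp only [hf]
    refine hφ0 _ ?_
    have hR' : (0 : ℝ) < R₀ := by exact_mod_cast hR₀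
    rw [abs_div, abs_of_pos hR', le_div_iff₀ hR', one_mul]
    exact_mod_cast hm
  have hsec := fwdDiff_iter_comp_section (P := P) (fun x : ZMod P => x.valMinAbs) f (fun _ : Fin 1 => (1 : ℤ)) 2
    (fun b t ht => section_consistent_valMinAbs f (fun _ : Fin 1 => (1 : ℤ)) 2 hsupp b t ht) a
  have hcast : (fun j : Fin 1 => (((fun _ : Fin 1 => (1 : ℤ)) j : ℤ) : ZMod P)) = fun _ : Fin 1 => (1 : ZMod P) := by
    funext j; simp
  rw [hcast] at hsec
  have hfeq : (fun b : TorusSite 1 P => f (fun j => (b j).valMinAbs)) = fun b : TorusSite 1 P => φ (((b 0).valMinAbs : ℝ) / R₀) := by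
    funext b; simp only [hf]
  rw [hfeq] at hsec
  rw [hsec]
  have hline := fwdDiff_iter_eq_of_line f (fun _ : Fin 1 => (1 : ℤ)) (fun j => (a j).valMinAbs)
    (fun s => φ ((((a 0).valMinAbs : ℝ) + s) / R₀)) (fun k => by simp [hf]) 2
  rw [hline]
  exact abs_fwdDiff_two_rescaled_le φ hφ hK (by exact_mod_cast hR₀) _

/-- **Space factor**: for `2R₁ + 4 ≤ L`, the second differences of `b ↦ φ(b̃₀/R₁)φ(b̃₁/R₁)` along the two axes are `≤ K/R₁²` pointwise (`|φ| ≤ 1`).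
[cite: Katznelson2004, Ch. I §6.3] -/
theorem abs_fwdDiff_two_spaceBump_le {L : ℕ} [NeZero L] (φ : ℝ → ℝ) (hφ : ContDiff ℝ 2 φ) {K : ℝ} (hK : ∀ t, |iteratedDeriv 2 φ t| ≤ K)
    (hφ1 : ∀ t, |φ t| ≤ 1) (hφ0 : ∀ t, 1 ≤ |t| → φ t = 0) {R₁ : ℕ} (hR₁ : 0 < R₁) (hL : 2 * R₁ + 4 ≤ L) (b : TorusSite 2 L) (i : Fin 2) :
    |((fwdDiff (Pi.single i (1 : ZMod L) : TorusSite 2 L))^[2]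
        (fun b : TorusSite 2 L => φ (((b 0).valMinAbs : ℝ) / R₁) * φ (((b 1).valMinAbs : ℝ) / R₁))) b| ≤ K / (R₁ : ℝ) ^ 2 := by
  have hR' : (0 : ℝ) < R₁ := by exact_mod_cast hR₁
  have hK0 : 0 ≤ K := (abs_nonneg _).trans (hK 0)
  set f : (Fin 2 → ℤ) → ℝ := fun m => φ ((m 0 : ℝ) / R₁) * φ ((m 1 : ℝ) / R₁) with hf
  set v : Fin 2 → ℤ := Pi.single i 1 with hv
  have hvan : ∀ m : Fin 2 → ℤ, ∀ j, (R₁ : ℤ) ≤ |m j| → f m = 0 := by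
    intro m j hj
    have hj2 : j = 0 ∨ j = 1 := by fin_cases j <;> simp
    rcases hj2 with rfl | rfl
    · have hz : φ ((m 0 : ℝ) / R₁) = 0 := by
        refine hφ0 _ ?_
        rw [abs_div, abs_of_pos hR', le_div_iff₀ hR', one_mul]; exact_mod_cast hj
      simp only [hf, hz, zero_mul]
    · have hz : φ ((m 1 : ℝ) / R₁) = 0 := by
        refine hφ0 _ ?_
        rw [abs_div, abs_of_pos hR', le_div_iff₀ hR', one_mul]; exact_mod_cast hj
      simp only [hf, hz, mul_zero]
  have hsupp : ∀ m : Fin 2 → ℤ, (∃ j, (L : ℤ) ≤ 2 * |m j| + 2 * (2 : ℕ) * |v j|) → f m = 0 := by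
    rintro m ⟨j, hj⟩
    refine hvan m j ?_
    have hvj : |v j| ≤ 1 := by
      simp only [hv, Pi.single_apply]
      split_ifs <;> simp
    push_cast at hj hL ⊢
    nlinarith [hvj, abs_nonneg (v j), abs_nonneg (m j)]
  have hsec := fwdDiff_iter_comp_section (P := L) (fun x : ZMod L => x.valMinAbs) f v 2
    (fun b t ht => section_consistent_valMinAbs f v 2 hsupp b t ht) b
  have hcast : (fun j : Fin 2 => ((v j : ℤ) : ZMod L)) = (Pi.single i (1 : ZMod L) : TorusSite 2 L) := by
    funext j; simp only [hv, Pi.single_apply]; split_ifs <;> simp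
  rw [hcast] at hsec
  have hfeq : (fun b : TorusSite 2 L => f (fun j => (b j).valMinAbs)) =
      fun b : TorusSite 2 L => φ (((b 0).valMinAbs : ℝ) / R₁) * φ (((b 1).valMinAbs : ℝ) / R₁) := by
    funext b; simp only [hf]
  rw [hfeq] at hsec
  rw [hsec]
  -- along the axis `i` the restriction to the line is `s ↦ φ((m̃ᵢ + s)/R₁) · φ(m̃ᵢ'/R₁)`
  set m : Fin 2 → ℤ := fun j => (b j).valMinAbs with hm
  fin_cases i
  · have hline := fwdDiff_iter_eq_of_line f v m (fun s => φ (((m 0 : ℝ) + s) / R₁) * φ ((m 1 : ℝ) / R₁)) (fun k => by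
        simp [hf, hv]) 2
    rw [hline]
    have hprod : ((fwdDiff (1 : ℝ))^[2] (fun s => φ (((m 0 : ℝ) + s) / R₁) * φ ((m 1 : ℝ) / R₁))) 0 =
        ((fwdDiff (1 : ℝ))^[2] (fun s => φ (((m 0 : ℝ) + s) / R₁))) 0 * φ ((m 1 : ℝ) / R₁) := by
      simp only [Function.iterate_succ, Function.iterate_zero, Function.comp_apply, fwdDiff, Function.id_def]
      ring
    rw [hprod, abs_mul]
    calc |((fwdDiff (1 : ℝ))^[2] (fun s => φ (((m 0 : ℝ) + s) / R₁))) 0| * |φ ((m 1 : ℝ) / R₁)|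
        ≤ K / (R₁ : ℝ) ^ 2 * 1 := mul_le_mul (abs_fwdDiff_two_rescaled_le φ hφ hK hR' _) (hφ1 _) (abs_nonneg _) (by positivity)
      _ = K / (R₁ : ℝ) ^ 2 := mul_one _
  · have hline := fwdDiff_iter_eq_of_line f v m (fun s => φ ((m 0 : ℝ) / R₁) * φ (((m 1 : ℝ) + s) / R₁)) (fun k => by
        simp [hf, hv]) 2
    rw [hline]
    have hprod : ((fwdDiff (1 : ℝ))^[2] (fun s => φ ((m 0 : ℝ) / R₁) * φ (((m 1 : ℝ) + s) / R₁))) 0 =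
        φ ((m 0 : ℝ) / R₁) * ((fwdDiff (1 : ℝ))^[2] (fun s => φ (((m 1 : ℝ) + s) / R₁))) 0 := by
      simp only [Function.iterate_succ, Function.iterate_zero, Function.comp_apply, fwdDiff, Function.id_def]
      ring
    rw [hprod, abs_mul]
    calc |φ ((m 0 : ℝ) / R₁)| * |((fwdDiff (1 : ℝ))^[2] (fun s => φ (((m 1 : ℝ) + s) / R₁))) 0|
        ≤ 1 * (K / (R₁ : ℝ) ^ 2) := mul_le_mul (hφ1 _) (abs_fwdDiff_two_rescaled_le φ hφ hK hR' _) (abs_nonneg _) zero_le_one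
      _ = K / (R₁ : ℝ) ^ 2 := one_mul _

/-! ### §4 The product bump on `(ℤ/P)¹ × (ℤ/L)²` -/

/-- Iterated differences of a product with a factor constant along the direction. [folklore] -/
theorem fwdDiff_iter_mul_const_real {A : Type*} [AddCommMonoid A] (f : A → ℝ) (c : ℝ) (v : A) (N : ℕ) (a : A) :
    ((fwdDiff v)^[N] (fun x => f x * c)) a = ((fwdDiff v)^[N] f) a * c := by
  rw [fwdDiff_iter_eq_sum_shift, fwdDiff_iter_eq_sum_shift, sum_mul]
  refine sum_congr rfl fun k _ => ?_
  rw [smul_mul_assoc]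

/-- Iterated differences of a product with a factor constant along the direction (constant on the left). [folklore] -/
theorem fwdDiff_iter_const_mul_real {A : Type*} [AddCommMonoid A] (f : A → ℝ) (c : ℝ) (v : A) (N : ℕ) (a : A) :
    ((fwdDiff v)^[N] (fun x => c * f x)) a = c * ((fwdDiff v)^[N] f) a := by
  have h := fwdDiff_iter_mul_const_real f c v N a
  have hfun : (fun x => c * f x) = fun x => f x * c := funext fun x => mul_comm _ _
  rw [hfun, h, mul_comm]

/-- **Bump data of the canonical product bump** `G(q) = φ(q̃₁/R₀)·φ((q̃₂)₀/R₁)·φ((q̃₂)₁/R₁)`: `‖G‖ ≤ 1`; `#{G ≠ 0} ≤ 64·R₀R₁²`; time second difference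
`≤ K/R₀²` (`2R₀ + 4 ≤ P`); axis second differences `≤ K/R₁²` (`2R₁ + 4 ≤ L`). [cite: Katznelson2004, Ch. I §6.3] -/
theorem productBump_bumpData {P L : ℕ} [NeZero P] [NeZero L] (φ : ℝ → ℝ) (hφ : ContDiff ℝ 2 φ) {K : ℝ}
    (hK : ∀ t, |iteratedDeriv 2 φ t| ≤ K) (hφ1 : ∀ t, |φ t| ≤ 1) (hφ0 : ∀ t, 1 ≤ |t| → φ t = 0)
    {R₀ R₁ : ℕ} (hR₀ : 0 < R₀) (hR₁ : 0 < R₁) (hP : 2 * R₀ + 4 ≤ P) (hL : 2 * R₁ + 4 ≤ L) :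
    let G : TorusSite 1 P × TorusSite 2 L → ℂ := fun q =>
      ((φ (((q.1 0).valMinAbs : ℝ) / R₀) * (φ (((q.2 0).valMinAbs : ℝ) / R₁) * φ (((q.2 1).valMinAbs : ℝ) / R₁)) : ℝ) : ℂ)
    (∀ q, ‖G q‖ ≤ 1) ∧
    ((univ.filter fun q => G q ≠ 0).card ≤ 64 * R₀ * R₁ ^ 2) ∧
    (∀ q, ‖(fwdDiff ((fun _ : Fin 1 => (1 : ZMod P)), (0 : TorusSite 2 L)))^[2] G q‖ ≤ K / (R₀ : ℝ) ^ 2) ∧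
    (∀ q (i : Fin 2), ‖(fwdDiff ((0 : TorusSite 1 P), (Pi.single i (1 : ZMod L) : TorusSite 2 L)))^[2] G q‖ ≤ K / (R₁ : ℝ) ^ 2) := by
  classical
  intro G
  set T : TorusSite 1 P → ℝ := fun a => φ (((a 0).valMinAbs : ℝ) / R₀) with hT
  set S : TorusSite 2 L → ℝ := fun b => φ (((b 0).valMinAbs : ℝ) / R₁) * φ (((b 1).valMinAbs : ℝ) / R₁) with hS
  have hG : ∀ q, G q = ((T q.1 * S q.2 : ℝ) : ℂ) := fun q => rfl
  have hT1 : ∀ a, |T a| ≤ 1 := fun a => hφ1 _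
  have hS1 : ∀ b, |S b| ≤ 1 := fun b => by
    rw [hS, abs_mul]
    exact mul_le_one₀ (hφ1 _) (abs_nonneg _) (hφ1 _)
  refine ⟨fun q => ?_, ?_, fun q => ?_, fun q i => ?_⟩
  · -- sup
    rw [hG, Complex.norm_real, Real.norm_eq_abs, abs_mul]
    exact mul_le_one₀ (hT1 _) (abs_nonneg _) (hS1 _)
  · -- support: inject into the product of the one-dimensional supports
    have hsub : (univ.filter fun q : TorusSite 1 P × TorusSite 2 L => G q ≠ 0) ⊆
        ((univ.filter fun a : TorusSite 1 P => T a ≠ 0) ×ˢ (univ.filter fun b : TorusSite 2 L => S b ≠ 0)) := by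
      intro q hq
      simp only [mem_filter, mem_univ, true_and, mem_product] at hq ⊢
      rw [hG] at hq
      have h' : T q.1 * S q.2 ≠ 0 := by
        intro h0; apply hq; rw [h0]; simp
      exact ⟨left_ne_zero_of_mul h', right_ne_zero_of_mul h'⟩
    refine (card_le_card hsub).trans ?_
    rw [card_product]
    -- time support ≤ 4R₀
    have hTcard : (univ.filter fun a : TorusSite 1 P => T a ≠ 0).card ≤ 4 * R₀ := by
      have h1 := card_support_sampledBump_le (n := P) φ hφ0 hR₀
      refine le_trans ?_ h1
      refine card_le_card_of_injOn (fun a : TorusSite 1 P => a 0) (fun a ha => ?_) (fun a₁ _ a₂ _ h => ?_)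
      · simp only [coe_filter, mem_univ, true_and, Set.mem_setOf_eq] at ha ⊢
        simpa [hT] using ha
      · funext j; rw [Subsingleton.elim j 0]; exact h
    -- space support ≤ (4R₁)²
    have hScard : (univ.filter fun b : TorusSite 2 L => S b ≠ 0).card ≤ (4 * R₁) * (4 * R₁) := by
      have h1 := card_support_sampledBump_le (n := L) φ hφ0 hR₁
      have hsub2 : (univ.filter fun b : TorusSite 2 L => S b ≠ 0) ⊆
          (((univ.filter fun x : ZMod L => φ ((x.valMinAbs : ℝ) / R₁) ≠ 0) ×ˢ
            (univ.filter fun x : ZMod L => φ ((x.valMinAbs : ℝ) / R₁) ≠ 0)).image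
            fun p : ZMod L × ZMod L => (![p.1, p.2] : TorusSite 2 L)) := by
        intro b hb
        simp only [mem_filter, mem_univ, true_and] at hb
        rw [hS] at hb
        refine mem_image.2 ⟨(b 0, b 1), ?_, ?_⟩
        · simp only [mem_product, mem_filter, mem_univ, true_and]
          exact ⟨left_ne_zero_of_mul hb, right_ne_zero_of_mul hb⟩
        · funext j; fin_cases j <;> rfl
      refine (card_le_card hsub2).trans (card_image_le.trans ?_)
      rw [card_product]
      exact Nat.mul_le_mul h1 h1
    calc (univ.filter fun a : TorusSite 1 P => T a ≠ 0).card * (univ.filter fun b : TorusSite 2 L => S b ≠ 0).card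
        ≤ (4 * R₀) * ((4 * R₁) * (4 * R₁)) := Nat.mul_le_mul hTcard hScard
      _ = 64 * R₀ * R₁ ^ 2 := by ring
  · -- time second difference
    have h1 : ((fwdDiff ((fun _ : Fin 1 => (1 : ZMod P)), (0 : TorusSite 2 L)))^[2] G) q =
        ((((fwdDiff (fun _ : Fin 1 => (1 : ZMod P)))^[2] T) q.1 * S q.2 : ℝ) : ℂ) := by
      rw [fwdDiff_iter_prod_fst]
      have hfun : (fun a : TorusSite 1 P => G (a, q.2)) = fun a => ((T a * S q.2 : ℝ) : ℂ) := funext fun a => hG (a, q.2)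
      rw [hfun]
      -- the real-to-complex coercion commutes with differences
      have hco : ∀ (n : ℕ) (g : TorusSite 1 P → ℝ) (a : TorusSite 1 P),
          ((fwdDiff (fun _ : Fin 1 => (1 : ZMod P)))^[n] (fun a => ((g a : ℝ) : ℂ))) a =
            ((((fwdDiff (fun _ : Fin 1 => (1 : ZMod P)))^[n] g) a : ℝ) : ℂ) := by
        intro n g a
        rw [fwdDiff_iter_eq_sum_shift, fwdDiff_iter_eq_sum_shift]
        push_cast
        refine sum_congr rfl fun k _ => ?_
        simp [zsmul_eq_mul]
      rw [hco, fwdDiff_iter_mul_const_real]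
    rw [h1, Complex.norm_real, Real.norm_eq_abs, abs_mul]
    have hK0 : 0 ≤ K / (R₀ : ℝ) ^ 2 := div_nonneg ((abs_nonneg _).trans (hK 0)) (by positivity)
    calc |((fwdDiff (fun _ : Fin 1 => (1 : ZMod P)))^[2] T) q.1| * |S q.2| ≤ K / (R₀ : ℝ) ^ 2 * 1 :=
          mul_le_mul (abs_fwdDiff_two_timeBump_le φ hφ hK hφ0 hR₀ hP q.1) (hS1 _) (abs_nonneg _) hK0
      _ = K / (R₀ : ℝ) ^ 2 := mul_one _
  · -- space second differences
    have h1 : ((fwdDiff ((0 : TorusSite 1 P), (Pi.single i (1 : ZMod L) : TorusSite 2 L)))^[2] G) q =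
        (((T q.1 * ((fwdDiff (Pi.single i (1 : ZMod L) : TorusSite 2 L))^[2] S) q.2 : ℝ)) : ℂ) := by
      rw [fwdDiff_iter_prod_snd]
      have hfun : (fun b : TorusSite 2 L => G (q.1, b)) = fun b => ((T q.1 * S b : ℝ) : ℂ) := funext fun b => hG (q.1, b)
      rw [hfun]
      have hco : ∀ (n : ℕ) (g : TorusSite 2 L → ℝ) (b : TorusSite 2 L),
          ((fwdDiff (Pi.single i (1 : ZMod L) : TorusSite 2 L))^[n] (fun b => ((g b : ℝ) : ℂ))) b =
            ((((fwdDiff (Pi.single i (1 : ZMod L) : TorusSite 2 L))^[n] g) b : ℝ) : ℂ) := by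
        intro n g b
        rw [fwdDiff_iter_eq_sum_shift, fwdDiff_iter_eq_sum_shift]
        push_cast
        refine sum_congr rfl fun k _ => ?_
        simp [zsmul_eq_mul]
      rw [hco, fwdDiff_iter_const_mul_real]
    rw [h1, Complex.norm_real, Real.norm_eq_abs, abs_mul]
    have hK0 : 0 ≤ K / (R₁ : ℝ) ^ 2 := div_nonneg ((abs_nonneg _).trans (hK 0)) (by positivity)
    calc |T q.1| * |((fwdDiff (Pi.single i (1 : ZMod L) : TorusSite 2 L))^[2] S) q.2| ≤ 1 * (K / (R₁ : ℝ) ^ 2) :=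
          mul_le_mul (hT1 _) (abs_fwdDiff_two_spaceBump_le φ hφ hK hφ1 hφ0 hR₁ hL q.2 i) (abs_nonneg _) zero_le_one
      _ = K / (R₁ : ℝ) ^ 2 := one_mul _

/-- **The normalised `ℓ¹` norm of the canonical product bump is `O(1)` at every scale**: with `K ≥ 1`, `4R₀ ≤ P`, `4R₁ ≤ L` (and the data of
`productBump_bumpData`), `Σ_z ‖Σ_q χ_{q₁}(z₁)χ_{q₂}(z₂)•G(q)‖ ≤ √(10485760·(K·√K)) · (P·L²)`. [cite: Katznelson2004, Ch. I §6.3] -/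
theorem sum_norm_charSum_productBump_le {P L : ℕ} [NeZero P] [NeZero L] (φ : ℝ → ℝ) (hφ : ContDiff ℝ 2 φ) {K : ℝ} (hK1 : 1 ≤ K)
    (hK : ∀ t, |iteratedDeriv 2 φ t| ≤ K) (hφ1 : ∀ t, |φ t| ≤ 1) (hφ0 : ∀ t, 1 ≤ |t| → φ t = 0)
    {R₀ R₁ : ℕ} (hR₀ : 0 < R₀) (hR₁ : 0 < R₁) (hP : 4 * R₀ ≤ P) (hL : 4 * R₁ ≤ L) (hP' : 2 * R₀ + 4 ≤ P) (hL' : 2 * R₁ + 4 ≤ L) :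
    ∑ z : TorusSite 1 P × TorusSite 2 L, ‖∑ q : TorusSite 1 P × TorusSite 2 L, (torusChar q.1 z.1 * torusChar q.2 z.2) •
      (((φ (((q.1 0).valMinAbs : ℝ) / R₀) * (φ (((q.2 0).valMinAbs : ℝ) / R₁) * φ (((q.2 1).valMinAbs : ℝ) / R₁)) : ℝ) : ℂ))‖ ≤
      Real.sqrt (10485760 * (K * Real.sqrt K)) * ((P : ℝ) * (L : ℝ) ^ 2) := by
  obtain ⟨hsup, hsupp, h₀, h₁⟩ := productBump_bumpData (P := P) (L := L) φ hφ hK hφ1 hφ0 hR₀ hR₁ hP' hL'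
  have hK0 : 0 < K := lt_of_lt_of_le one_pos hK1
  have hsK : 0 < Real.sqrt K := Real.sqrt_pos.2 hK0
  have hsK1 : 1 ≤ Real.sqrt K := by rw [← Real.sqrt_one]; exact Real.sqrt_le_sqrt hK1
  have hsKsq : Real.sqrt K ^ 2 = K := Real.sq_sqrt hK0.le
  have hPpos : (0 : ℝ) < P := by exact_mod_cast lt_of_lt_of_le (by omega : 0 < 4 * R₀) hP
  have hLpos : (0 : ℝ) < L := by exact_mod_cast lt_of_lt_of_le (by omega : 0 < 4 * R₁) hL
  have hR₀' : (0 : ℝ) < R₀ := by exact_mod_cast hR₀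
  have hR₁' : (0 : ℝ) < R₁ := by exact_mod_cast hR₁
  -- rates
  set s₀ : ℝ := 4 * R₀ / (Real.sqrt K * P) with hs₀
  set s₁ : ℝ := 4 * R₁ / (Real.sqrt K * L) with hs₁
  have hs₀pos : 0 < s₀ := by positivity
  have hs₁pos : 0 < s₁ := by positivity
  have hs₀1 : s₀ ≤ 1 := by
    rw [hs₀, div_le_one (by positivity)]
    have : (4 * R₀ : ℝ) ≤ P := by exact_mod_cast hP
    nlinarith
  have hs₁1 : s₁ ≤ 1 := by
    rw [hs₁, div_le_one (by positivity)]
    have : (4 * R₁ : ℝ) ≤ L := by exact_mod_cast hL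
    nlinarith
  have hs₀P : s₀ * P = 4 * R₀ / Real.sqrt K := by rw [hs₀]; field_simp
  have hs₁L : s₁ * L = 4 * R₁ / Real.sqrt K := by rw [hs₁]; field_simp
  -- the second-difference hypotheses in rate form: `K/R² = 1·(4/(s·P))²`
  have hsKne : Real.sqrt K ≠ 0 := hsK.ne'
  have h4₀ : 4 / (s₀ * P) = Real.sqrt K / R₀ := by
    rw [hs₀P, div_div_eq_mul_div, div_eq_div_iff (by positivity) hR₀'.ne']
    ring
  have h4₁ : 4 / (s₁ * L) = Real.sqrt K / R₁ := by
    rw [hs₁L, div_div_eq_mul_div, div_eq_div_iff (by positivity) hR₁'.ne']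
    ring
  have hrate₀ : K / (R₀ : ℝ) ^ 2 = 1 * (4 / (s₀ * P)) ^ 2 := by rw [h4₀, div_pow, hsKsq, one_mul]
  have hrate₁ : K / (R₁ : ℝ) ^ 2 = 1 * (4 / (s₁ * L)) ^ 2 := by rw [h4₁, div_pow, hsKsq, one_mul]
  -- support in rate form: `64 R₀ R₁² = (K√K)·(s₀P)(s₁L)²`
  have hNs : ((64 * R₀ * R₁ ^ 2 : ℕ) : ℝ) ≤ (K * Real.sqrt K) * (s₀ * P) * (s₁ * L) ^ 2 := by
    rw [hs₀P, hs₁L, div_pow, hsKsq]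
    have hKK : (K * Real.sqrt K) * (4 * (R₀ : ℝ) / Real.sqrt K) * ((4 * (R₁ : ℝ)) ^ 2 / K) = 64 * R₀ * R₁ ^ 2 := by
      field_simp
      ring
    rw [hKK]
    push_cast
    exact le_rfl
  have h := sum_norm_charSum_bump_le _ hs₀pos hs₀1 hs₁pos hs₁1 zero_le_one (by positivity) hNs hsupp hsup
    (fun q => (h₀ q).trans (le_of_eq hrate₀)) (fun q i => (h₁ q i).trans (le_of_eq hrate₁))
  exact h.trans (le_of_eq (mul_one _))

/-! ### §5 Translated symbols (transfers centred at a nesting vector) -/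

/-- The character sum of a translated symbol is a character times the character sum. [folklore] -/
theorem charSum_translate {P L : ℕ} [NeZero P] [NeZero L] (G : TorusSite 1 P × TorusSite 2 L → ℂ) (Q z : TorusSite 1 P × TorusSite 2 L) :
    ∑ q : TorusSite 1 P × TorusSite 2 L, (torusChar q.1 z.1 * torusChar q.2 z.2) • G (q - Q) =
      (torusChar Q.1 z.1 * torusChar Q.2 z.2) * ∑ q : TorusSite 1 P × TorusSite 2 L, (torusChar q.1 z.1 * torusChar q.2 z.2) • G q := by
  have hre : ∑ q : TorusSite 1 P × TorusSite 2 L, (torusChar q.1 z.1 * torusChar q.2 z.2) • G (q - Q) =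
      ∑ q : TorusSite 1 P × TorusSite 2 L, (torusChar (q + Q).1 z.1 * torusChar (q + Q).2 z.2) • G q := by
    refine (Fintype.sum_equiv (Equiv.addRight Q)
      (fun q => (torusChar (q + Q).1 z.1 * torusChar (q + Q).2 z.2) • G q)
      (fun q => (torusChar q.1 z.1 * torusChar q.2 z.2) • G (q - Q)) fun q => ?_).symm
    simp only [Equiv.coe_addRight, add_sub_cancel_right]
  rw [hre, mul_sum]
  refine sum_congr rfl fun q _ => ?_
  rw [Prod.fst_add, Prod.snd_add, smul_eq_mul, smul_eq_mul, torusChar_comm (q.1 + Q.1), torusChar_add_right,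
    torusChar_comm (q.2 + Q.2), torusChar_add_right, torusChar_comm z.1 q.1, torusChar_comm z.1 Q.1,
    torusChar_comm z.2 q.2, torusChar_comm z.2 Q.2]
  ring

/-- **Translating the symbol does not change the `ℓ¹` norm of the character sum.** [folklore] -/
theorem sum_norm_charSum_translate {P L : ℕ} [NeZero P] [NeZero L] (G : TorusSite 1 P × TorusSite 2 L → ℂ) (Q : TorusSite 1 P × TorusSite 2 L) :
    ∑ z : TorusSite 1 P × TorusSite 2 L, ‖∑ q : TorusSite 1 P × TorusSite 2 L, (torusChar q.1 z.1 * torusChar q.2 z.2) • G (q - Q)‖ =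
      ∑ z : TorusSite 1 P × TorusSite 2 L, ‖∑ q : TorusSite 1 P × TorusSite 2 L, (torusChar q.1 z.1 * torusChar q.2 z.2) • G q‖ := by
  refine sum_congr rfl fun z _ => ?_
  rw [charSum_translate, norm_mul, norm_mul, norm_torusChar, norm_torusChar, one_mul, one_mul]

end Summit.HubbardSuperconductivity.HubbardSuperconductivity.Theorems.TorusFourierL2

end
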